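import Summits.QuantumAdvantage.QuantumAdvantage.Theorems.CubicForrelationNearExactIsExactTwelveWeight768Hyperplane
import Summits.QuantumAdvantage.QuantumAdvantage.Theorems.CubicForrelationNearExactIsExactTwelveLevelFiveDuality
import Summits.QuantumAdvantage.QuantumAdvantage.Theorems.CubicForrelationNearExactIsExactWalshTower
import Summits.QuantumAdvantage.QuantumAdvantage.Theorems.CubicForrelationNearExactIsExactAxParity
import Summits.QuantumAdvantage.QuantumAdvantage.Theorems.CubicForrelationNearExactIsExactTenBalancedA

/-!
# Crux `CubicForrelation.NearExactIsExact` (stmt-QuantumAdvantage-14043) — n = 12 AT `Φ = 29/32`, configuration (β) × (β): the residual has a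
  non-zero SIGNED PERIOD, and the Walsh transform of `g` is `{0, ±64}`-valued on a hyperplane of frequencies

Certificate seat `b2b-cforr-cert` (gen 25).  HONEST FRAMING: finite-slice structure lemmas (standard axioms) about cubic Boolean pairs on 12 bits;
first bricks for the LAST open per-side configuration (β) × (β) at the boundary value `29/32` (plan HOME/b2b-cforr-cert-g25/PLAN-N12-928-BETA.md).
They do NOT decide (β) and claim NO value of `θ₁₂`.  NOT summit progress.

Setting: cubic `f, g`, `W_g = 64u''`, `W_f = 64w_f`; the PARTNER is in configuration (β): its even set `Z' = {w_f even}` has `768` points and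
`e' = w_f − (−1)^g` vanishes off `Z'`.  Then `Z'` is a weight-768 cubic support (Walsh tower), so by gen 15's `to15_weight768_in_hyperplane` it
lies in an affine hyperplane `{y : (−1)^{y·z} = t}`, `z ≠ 0`; by the two-sided duality `Σ_y e'(y)(−1)^{x·y} = −64·e(x)` (`l5k_duality` for
`(g,f)`) the residual `e = u'' − (−1)^f` satisfies `e(x ⊕ z) = t·e(x)` for all `x` (`tb25_signed_period`).  Consequently
`u''(x ⊕ z) − t·u''(x) = (−1)^{f(x⊕z)} − t·(−1)^{f(x)} ∈ {0, ±2}` (`tb25_walsh_pair`): `W_g(x ⊕ z) − t·W_g(x) ∈ {0, ±128}`, i.e. the restriction of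
`g` to the affine hyperplane `{y : (−1)^{y·z} = −t}` is an 11-variable SEMI-BENT function whose Walsh support is a level set of the quadratic
derivative `D_z f`.

References: T. Kasami, N. Tokura (1970); MacWilliams–Sloane (1977) Ch. 15; R. O'Donnell (2014) §1.4.  Axioms: the standard three.
-/

set_option linter.dupNamespace false -- D-0017: single-problem summit ⇒ `QuantumAdvantage.QuantumAdvantage` by design

noncomputable section

namespace Summit.QuantumAdvantage.QuantumAdvantage.Theorems.CubicForrelation.NearExactIsExact

open Finset
open Literature.Computability.QuantumComplexity
open Literature.Computability.QuantumComplexity.BuzetChailloux (bxor zeroVec bxor_bxor_cancel_left bxor_zeroVec zeroVec_bxor bxor_comm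
  bxor_self twist_bxor_right)
open Literature.Computability.QuantumComplexity.DerivativeWalsh (W)

/-- **Signed period of the residual when the partner is in configuration (β).**  Cubic `f, g`, `W_g = 64u''`, `W_f = 64w_f`, `#{w_f even} = 768`
and `w_f = (−1)^g` off `{w_f even}`: there are `z ≠ 0` and `t = ±1` with `(u'' − (−1)^f)(x ⊕ z) = t·(u'' − (−1)^f)(x)` for every `x`.
[this work] -/
theorem tb25_signed_period (f g : (Fin (6 + 6) → Bool) → Bool) (hf : IsDegLeFun 3 f)
    (u'' : (Fin (6 + 6) → Bool) → ℤ) (hu'' : ∀ x, W (fun y => signOf (g y)) x = (2 : ℝ) ^ 6 * (u'' x : ℝ))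
    (wf : (Fin (6 + 6) → Bool) → ℤ) (hwf : ∀ y, W (fun x => signOf (f x)) y = (2 : ℝ) ^ 6 * (wf y : ℝ))
    (h768 : #(univ.filter fun y : Fin (6 + 6) → Bool => ¬ Odd (wf y)) = 768)
    (hoff' : ∀ y, y ∉ (univ.filter fun y : Fin (6 + 6) → Bool => ¬ Odd (wf y)) → wf y - sZ (g y) = 0) :
    ∃ z : Fin (6 + 6) → Bool, z ≠ zeroVec ∧ ∃ t : ℤ, (t = 1 ∨ t = -1) ∧
      ∀ x, u'' (bxor x z) - sZ (f (bxor x z)) = t * (u'' x - sZ (f x)) := by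
  classical
  set Z' := (univ.filter fun y : Fin (6 + 6) → Bool => ¬ Odd (wf y)) with hZ'def
  -- `Z'` is a weight-768 cubic support
  have hp : IsDegLeFun 3 (fun y => decide (Odd (wf y))) :=
    stub_walshTower stub_axParity (6 + 6) 6 3 f wf hf hwf (by intro k hk hkn; omega)
  have hp' : IsDegLeFun 3 (fun y => decide (Odd (wf y)) ^^ true) := tb_isDegLeFun_xor_const hp true
  have hfilt : (univ.filter fun y : Fin (6 + 6) → Bool => (decide (Odd (wf y)) ^^ true) = true) = Z' :=
    filter_congr fun y _ => by simp
  obtain ⟨z, t, hz, ht, hhyp⟩ := to15_weight768_in_hyperplane (fun y => decide (Odd (wf y)) ^^ true) hp' (by rw [hfilt, h768])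
  have hhyp' : ∀ y ∈ Z', twist y z = t := by
    intro y hy
    exact hhyp y (by simpa using (mem_filter.1 hy).2)
  -- the integer `t`
  obtain ⟨tz, htz, htzR⟩ : ∃ tz : ℤ, (tz = 1 ∨ tz = -1) ∧ (t : ℝ) = (tz : ℝ) := by
    rcases ht with h | h
    · exact ⟨1, Or.inl rfl, by rw [h]; norm_num⟩
    · exact ⟨-1, Or.inr rfl, by rw [h]; norm_num⟩
  refine ⟨z, hz, tz, htz, fun x => ?_⟩
  -- duality for `(g, f)`: `Σ_y e'(y) (−1)^{y·x} = −64 e(x)`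
  have hu' : ∀ x, W (fun y => signOf (g y)) x = (2 : ℝ) ^ 5 * (((2 * u'' x : ℤ)) : ℝ) := fun x => by rw [hu'' x]; push_cast; ring
  have huf : ∀ y, W (fun x => signOf (f x)) y = (2 : ℝ) ^ 5 * (((2 * wf y : ℤ)) : ℝ) := fun y => by rw [hwf y]; push_cast; ring
  have hdual : ∀ x : Fin (6 + 6) → Bool, ∑ y, (((wf y - sZ (g y) : ℤ)) : ℝ) * twist y x = -64 * (((u'' x - sZ (f x) : ℤ)) : ℝ) := by
    intro x
    have h := l5k_duality g f (fun y => 2 * wf y) huf (fun x => 2 * u'' x) hu' x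
    have e2 : ∑ a, (((2 * wf a - 2 * sZ (g a) : ℤ)) : ℝ) * twist a x = 2 * ∑ a, (((wf a - sZ (g a) : ℤ)) : ℝ) * twist a x := by
      rw [mul_sum]; exact sum_congr rfl fun a _ => by push_cast; ring
    rw [e2] at h
    have : ∑ a, (((wf a - sZ (g a) : ℤ)) : ℝ) * twist a x = -32 * (((2 * u'' x - 2 * sZ (f x) : ℤ)) : ℝ) := by linarith
    rw [this]; push_cast; ring
  -- the sum is supported on `Z'`, where `twist y z = t`
  have hshift : ∑ y, (((wf y - sZ (g y) : ℤ)) : ℝ) * twist y (bxor x z) = (t : ℝ) * ∑ y, (((wf y - sZ (g y) : ℤ)) : ℝ) * twist y x := by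
    rw [mul_sum]
    refine sum_congr rfl fun y _ => ?_
    by_cases hy : y ∈ Z'
    · rw [twist_bxor_right, hhyp' y hy]; ring
    · rw [hoff' y hy]; push_cast; ring
  have h1 := hdual (bxor x z)
  rw [hshift, hdual x, htzR] at h1
  push_cast at h1
  have h2 : ((u'' (bxor x z) : ℤ) : ℝ) - ((sZ (f (bxor x z)) : ℤ) : ℝ) = (tz : ℝ) * (((u'' x : ℤ) : ℝ) - ((sZ (f x) : ℤ) : ℝ)) := by
    linear_combination (1 / 64 : ℝ) * h1
  exact_mod_cast h2

/-- **The Walsh transform of `g` on the paired hyperplane is `{0, ±64}`-valued.**  In the situation of `tb25_signed_period` (with its `z, t`):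
`u''(x ⊕ z) − t·u''(x) = (−1)^{f(x ⊕ z)} − t·(−1)^{f(x)}` for every `x`, so `W_g(x⊕z) − t·W_g(x) ∈ {0, ±128}` and it is `±128` exactly when the
derivative `f(x) ⊕ f(x ⊕ z)` equals `[t = 1]`. [this work] -/
theorem tb25_walsh_pair (f : (Fin (6 + 6) → Bool) → Bool) (u'' : (Fin (6 + 6) → Bool) → ℤ) (z : Fin (6 + 6) → Bool) (t : ℤ)
    (hper : ∀ x, u'' (bxor x z) - sZ (f (bxor x z)) = t * (u'' x - sZ (f x))) (x : Fin (6 + 6) → Bool) :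
    u'' (bxor x z) - t * u'' x = sZ (f (bxor x z)) - t * sZ (f x) := by
  have h := hper x
  linarith

/-- **Translation invariance of the even set.**  In the situation of `tb25_signed_period`, if moreover the residual `u'' − (−1)^f` vanishes exactly
off `Z = {u'' even}` (configuration (β) on the `g`-side), then `Z ⊕ z = Z`. [this work] -/
theorem tb25_Z_invariant (f : (Fin (6 + 6) → Bool) → Bool) (u'' : (Fin (6 + 6) → Bool) → ℤ) (z : Fin (6 + 6) → Bool) (t : ℤ)
    (ht : t = 1 ∨ t = -1) (hper : ∀ x, u'' (bxor x z) - sZ (f (bxor x z)) = t * (u'' x - sZ (f x)))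
    (hZ1 : ∀ x ∈ (univ.filter fun x : Fin (6 + 6) → Bool => ¬ Odd (u'' x)), (u'' x - sZ (f x)) ^ 2 = 1)
    (hoff : ∀ y, y ∉ (univ.filter fun x : Fin (6 + 6) → Bool => ¬ Odd (u'' x)) → u'' y - sZ (f y) = 0)
    (x : Fin (6 + 6) → Bool) :
    x ∈ (univ.filter fun x : Fin (6 + 6) → Bool => ¬ Odd (u'' x)) ↔ bxor x z ∈ (univ.filter fun x : Fin (6 + 6) → Bool => ¬ Odd (u'' x)) := by
  classical
  set Z := (univ.filter fun x : Fin (6 + 6) → Bool => ¬ Odd (u'' x)) with hZdef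
  have ht2 : t ^ 2 = 1 := by rcases ht with h | h <;> rw [h] <;> norm_num
  constructor
  · intro hx
    by_contra hxz
    have h0 := hoff _ hxz
    have h1 := hZ1 x hx
    rw [hper x] at h0
    have : (u'' x - sZ (f x)) ^ 2 = 0 := by
      have ht0 : t ≠ 0 := by rcases ht with h | h <;> rw [h] <;> norm_num
      have := (mul_eq_zero.1 h0).resolve_left ht0
      rw [this]; ring
    rw [h1] at this
    exact one_ne_zero this
  · intro hxz
    by_contra hx
    have h0 := hoff x hx
    have h1 := hZ1 _ hxz
    rw [hper x, h0, mul_zero] at h1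
    norm_num at h1

end Summit.QuantumAdvantage.QuantumAdvantage.Theorems.CubicForrelation.NearExactIsExact

end
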